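import Literature.MathematicalPhysics.QuantumFieldTheory.Balaban1983to89.B6SectAWholeTorusBridge

/-!
# `Balaban1983to89.B6SectAWholeTorusSectE` — T. Bałaban, *Propagators and renormalization transformations for lattice gauge
# theories. I*, Commun. Math. Phys. **95** (1984) 17–40 [Balaban1984PropagatorsI], Sect. E pp. 29–34: (1.68)–(1.69)
# `Δ_a = ∂*∂ + ∂R∂* + aQ*Q`, the Lagrange system (1.92) `Δ_aA + Q*ω + ∂λ = 0, QA = B, R∂*A = 0` and its resolution (1.97)–(1.98)
# `λ = 0, A = −GQ*ω`, (1.102) `−ω = (QGQ*)⁻¹B`, **(1.103) `H_kB = GQ*(QGQ*)⁻¹B`** — ON THE V1 LATTICE CALCULUS, obtained as the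
# whole-torus case `Ω₁ = … = Ω_k = T_η` of T. Bałaban, *… II*, Commun. Math. Phys. **96** (1984) [Balaban1984PropagatorsII] Sect. A
# (2.19), (2.21)–(2.23), (2.35) (p21's concrete `deltaAE`/`GE`/`EE`/`critical221_V1` at `B6SectADomainsV1.Domains.whole k`) through
# this seat's `B6SectAWholeTorusBridge` (`hOp_whole_eq_Hk`: (2.35) there = p11's (4.4.2) `Hk (opsV1 P k c s)`); companion file 3/3

statement-level skeleton of published theorems with citation tags; proofs where landed; nothing here is a claim about the
Yang–Mills mass gap

PDF held: `paper:balaban1984-cmp95-propagators-rt-i` (journal page = PDF page + 16; pp. 29–30, 33–34 [PDF 13–14, 17–18], text layer);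
`paper:balaban1984-cmp96-propagators-rt-ii` (journal page = PDF page + 222; p. 226 [PDF 4]).

PRINT, verbatim (text layer).  [B5] p. 29: «The integral (1.47) can be written in the following way … (1.68) The additional terms
vanish because of the delta-functions. The quadratic form in the fields A in the exponential is equal to … (1.69) Δ = ∂*∂ + ∂∂*,
R = I − P»; p. 30: «We will obtain an explicit representation of Δ_a⁻¹ = G_k, or simply G. (1.71) At first let us prove that Δ_a is a
positive operator.»; p. 33: «Let us now come back to the integral (1.68) and to a calculation of H_kB. It is defined as a minimum of
the form ½⟨A, Δ_aA⟩ − a⟨B, B⟩ under the conditions QA = B, R∂*A = 0. We introduce the function h(A, ω, λ) = ½⟨A, Δ_aA⟩ +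
⟨ω, QA − B⟩ + ⟨λ, R∂*A⟩, Rλ = λ, (1.91) ω and λ are Lagrange multipliers, and we solve the equations δh/δA = Δ_aA + Q*ω + ∂λ = 0,
δh/δω = QA − B = 0, δh/δλ = R∂*A = 0. (1.92) We get A = −GQ*ω − G∂λ, R∂*A = −R∂*GQ*ω − R∂*G∂λ = 0. (1.93) … R∂*GQ* = 0,
QG∂R = 0. (1.95)»; p. 34: «and from this it follows that R∂*G∂ = ∂*G∂R = R. (1.97) The equalities (1.95), (1.97) imply that the
second equation in (1.93) has the form Rλ = λ = 0. Thus we have A = −GQ*ω, (1.98) and the condition R∂*A = 0 is satisfied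
automatically. … The condition QA = B gives the equation −QGQ*ω = B, −ω = (QGQ*)⁻¹B, (1.102) so finally we get the representation
H_kB = GQ*(QGQ*)⁻¹B. (1.103) This representation allows us to reduce a proof of properties of H_k to the corresponding properties
of G.»  [B6] p. 226: «Δ_aA − ∂Rλ − Q*ω = 0, R∂*A = 0, QA − B = 0. (2.21)»; p. 228: «A = HB = GQ*(QGQ*)⁻¹B. (2.35)».

CITATION HEADER (lean-in-tree rule) — WHAT IS REPRODUCED.  Phase-2 file of the `lit-balaban` typed skeleton (HOME
`run/shared/lean/pub/lit-balaban/`), seat **p16 gen 5** (owners r02 (B5), r03 (B6), referee ref-4): V1 INSTANCES of SKELETON rows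
**B5.Eq1.69** / **B5.Eq1.93** / **B5.Eq1.97** / **B5.Eq1.103** (decls of record on the torus: `B5DeltaA169.DeltaA`,
`B5Eq191LagrangeG.h191`/`el192_A_eq_Hk`, `B5Identities197Torus.*` — untouched) as the whole-torus case of **B6.Eq2.19** / **B6.Eq2.21**
/ **B6.Eq2.35** (p21's `B6SectAVectorModelV1.deltaAE`/`inner_deltaAE_self`, `B6SectACriticalPointV1.critical221_V1`/`isCritical_hOp_V1` —
untouched), with `H_k` = p11's `BIJ85LandauMinimizer442.Hk` on `opsV1 P k c s` and [BIJ85]'s Landau form `LandauOps.energy` (p09).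
THEOREMS ONLY: no definition, no `def … : Prop`, nothing is a named unproved fact.

WHAT IS PROVED (kernel, no `sorry`, standard axioms; `k ≤ m + K`, `c ≠ 0`, `s ≠ 0` where stated, every `a = w > 0`, every `d ≥ 1`):
**`inner_deltaAE_whole`** — (1.69)/(2.19) at the whole torus as a quadratic form in p11's vocabulary: `⟨A, Δ_aA⟩ = s⁻²(‖∂A‖² +
‖R∂*A‖²) + Σ_{b∈𝔅} a(b)|(QA)(b)|²`; `inner_deltaAE_whole_eq_energy` (`= (2/s²)·E(A) + Σ a|QA|²`, `E` = [BIJ85]'s `½‖∂A‖² + ½‖R∂*A‖²`);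
**`critical221_whole`** ((2.21) ⟹ `λ = 0`, `ω = (QGQ*)⁻¹(QA₀)`, `A = H_k(Q_kA₀)`); **`eq192_whole`** — [B5] (1.92) IN ITS PRINTED SIGNS ⟹
(1.97)–(1.98) `λ = 0`, (1.102) `−ω = (QGQ*)⁻¹B`, (1.103) `A = H_kB`, `B = QA₀`, ON V1; `Hk_admissible_whole` (`H_k(Q_kA₀)` satisfies the
constraint equations).

READINGS / HONEST SCOPE.  (a) U = 1 real fields; `Λ₀ = ∅`; p21's `Domains` carries no metric clause.  (b) `G`, `(QGQ*)⁻¹` are p21's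
inverses `GE`/`EE` of the whole-torus `Δ_a`/`QGQ*` (they exist for every `a > 0`, `c ≠ 0`: p21's `deltaAE_bijective`, `qgqE_injective`);
[B5]'s (1.93)–(1.101) intermediate formulas (φ, Δ⁻¹, momentum representation) are NOT reproduced — only the resolution of (1.92) that
[B5] states in (1.97)–(1.98)/(1.102)–(1.103), via [B6]'s route (p21).  (c) p11's operators carry the weight `s`, p21's do not: hence
the factor `s⁻²` in `inner_deltaAE_whole`; the Lagrange statements are weight-free.  GAPS.md: nothing.
-/

open scoped InnerProductSpace

namespace Literature.MathematicalPhysics.QuantumFieldTheory.Balaban1983to89.B6SectAWholeTorusSectE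

open LatticeFieldCalculus B6SectADomainsV1 B6SectAOperatorsV1 B6SectAVectorModelV1 B6SectACriticalPointV1 B6SectAWholeTorusBridge
open BalabanImbrieJaffe1984to88.BIJ85AxialPropagator411 (BondSpace)
open BalabanImbrieJaffe1984to88.BIJ85LandauForm441 (LandauOps)
open BalabanImbrieJaffe1984to88.BIJ85LandauMinimizer442 (Hk)
open BalabanImbrieJaffe1984to88.BIJ85LandauMinimizer442V1 (opsV1 opsV1_Qk)

noncomputable section

variable {P : Params} {k : ℕ} (hk : k ≤ P.m + P.K) {c s : ℝ}

/-! ## [B5] Sect. E ON V1 at the whole torus: (1.68)–(1.69) `Δ_a`, (1.92) ⟹ (1.97)–(1.98)/(1.102)–(1.103)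
`Δ_aA + Q*ω + ∂λ = 0, QA = B, R∂*A = 0 ⟹ λ = 0, −ω = (QGQ*)⁻¹B, A = H_kB = GQ*(QGQ*)⁻¹B` — the one-level case of [B6] (2.19),
(2.21) ⟹ (2.35), with p21's CONSTRUCTED `G = GE`, `(QGQ*)⁻¹ = EE` at `Domains.whole k` and `H_k` = p11's (4.4.2) `Hk` -/

/-- **[B5] (1.69) `Δ_a = ∂*∂ + ∂R∂* + aQ*Q` on V1 IS [B6] (2.19) at the whole torus**, as a quadratic form in p11's (1.47)/(4.4.x)
vocabulary: `⟨A, Δ_aA⟩ = s⁻²(‖∂A‖² + ‖R∂*A‖²) + Σ_{b∈𝔅} a(b)|(QA)(b)|²` (`∂ = (opsV1 P k c s).curl`, `R∂* = projR ∘ dstar`; the (1.68)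
exponent `−½⟨∂A,∂A⟩ − ½‖R∂*A‖² − ½a‖B − Q_kA‖²` collects into `−½⟨A, Δ_aA⟩` plus `B`-terms). [cite: Balaban1984PropagatorsI, (1.68)–(1.69) p.29–30] -/
theorem inner_deltaAE_whole (c : ℝ) (hs : s ≠ 0) (w : BondIdx (Domains.whole (P := P) k hk) → ℝ) (x : BondSpace P) :
    ⟪x, deltaAE (Domains.whole (P := P) k hk) c w x⟫_ℝ =
      (s ^ 2)⁻¹ * (‖(opsV1 P k c s).curl x‖ ^ 2 + ‖(opsV1 P k c s).projR ((opsV1 P k c s).dstar x)‖ ^ 2) +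
        ∑ i, w i * QE (Domains.whole (P := P) k hk) x i ^ 2 := by
  have hs2 : s ^ 2 ≠ 0 := pow_ne_zero 2 hs
  rw [inner_deltaAE_self, curl_opsV1_eq_smul_dcE, dstar_opsV1_eq_smul_dsE, LinearMap.smul_apply, LinearMap.smul_apply, map_smul,
    ← RE_whole_apply hk c hs, norm_smul, norm_smul, Real.norm_eq_abs, mul_pow, mul_pow, sq_abs]
  field_simp

/-- **… = `(2/s²)·E(A) + Σ a|QA|²` with [BIJ85]'s Landau form `E(A) = ½‖∂A‖² + ½‖R∂*A‖²`** (p09's `LandauOps.energy`, the exponent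
of (4.4.2)/(1.64)). [cite: BalabanImbrieJaffe1985, (4.4.2) p.312] -/
theorem inner_deltaAE_whole_eq_energy (c : ℝ) (hs : s ≠ 0) (w : BondIdx (Domains.whole (P := P) k hk) → ℝ) (x : BondSpace P) :
    ⟪x, deltaAE (Domains.whole (P := P) k hk) c w x⟫_ℝ =
      2 * (s ^ 2)⁻¹ * (opsV1 P k c s).energy x + ∑ i, w i * QE (Domains.whole (P := P) k hk) x i ^ 2 := by
  rw [inner_deltaAE_whole hk c hs, LandauOps.energy]
  ring

/-- **[B6] (2.21) ⟹ (2.35) at the whole torus, with `H = H_k`**: every solution `(A, λ, ω)`, `Rλ = λ`, of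
`Δ_aA − ∂Rλ − Q*ω = 0, R∂*A = 0, QA = QA₀` has `λ = 0`, `ω = (QGQ*)⁻¹(QA₀)` and `A = H_k(Q_kA₀)` (p21's `critical221_V1` + `B6SectAWholeTorusBridge.hOp_whole_eq_Hk`).
[cite: Balaban1984PropagatorsII, (2.21)–(2.23) p.226 + (2.35) p.228] -/
theorem critical221_whole (hc : c ≠ 0) (hs : s ≠ 0) {w : BondIdx (Domains.whole (P := P) k hk) → ℝ} (hw : ∀ i, 0 < w i)
    {x₀ A : BondSpace P} {lam : ScalarSpace P} {ω : BondIdxSpace (Domains.whole (P := P) k hk)}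
    (hR : RE (Domains.whole (P := P) k hk) c lam = lam)
    (h1 : deltaAE (Domains.whole (P := P) k hk) c w A - dE c (RE (Domains.whole (P := P) k hk) c lam) -
      QsE (Domains.whole (P := P) k hk) ω = 0)
    (h2 : RE (Domains.whole (P := P) k hk) c (dsE c A) = 0)
    (h3 : QE (Domains.whole (P := P) k hk) A = QE (Domains.whole (P := P) k hk) x₀) :
    lam = 0 ∧ ω = EE (Domains.whole (P := P) k hk) hc hw (QE (Domains.whole (P := P) k hk) x₀) ∧
      A = Hk (opsV1 P k c s) ((opsV1 P k c s).Qk x₀) := by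
  obtain ⟨hl, hω, hA⟩ := critical221_V1 (Domains.whole (P := P) k hk) hc hw hR h1 h2 h3
  exact ⟨hl, hω, hA.trans (hOp_whole_eq_Hk hk hc hs hw x₀)⟩

/-- **[B5] (1.92) ⟹ (1.97)–(1.98), (1.102), (1.103) ON V1** (the printed signs of Sect. E: «Δ_aA + Q*ω + ∂λ = 0, QA = B, R∂*A = 0
(1.92) … Rλ = λ = 0 … A = −GQ*ω (1.98) … −ω = (QGQ*)⁻¹B (1.102) … H_kB = GQ*(QGQ*)⁻¹B (1.103)»): at the whole torus, for p21's `Δ_a`,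
`G`, `(QGQ*)⁻¹` and p11's `H_k`: every solution with `Rλ = λ` has `λ = 0`, `−ω = (QGQ*)⁻¹(QA₀)`, `A = H_k(Q_kA₀)` — every `a > 0`,
`c, s ≠ 0`. [cite: Balaban1984PropagatorsI, (1.92) p.33 + (1.103) p.34] -/
theorem eq192_whole (hc : c ≠ 0) (hs : s ≠ 0) {w : BondIdx (Domains.whole (P := P) k hk) → ℝ} (hw : ∀ i, 0 < w i)
    {x₀ A : BondSpace P} {lam : ScalarSpace P} {ω : BondIdxSpace (Domains.whole (P := P) k hk)}
    (hR : RE (Domains.whole (P := P) k hk) c lam = lam)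
    (h1 : deltaAE (Domains.whole (P := P) k hk) c w A + QsE (Domains.whole (P := P) k hk) ω + dE c lam = 0)
    (h2 : QE (Domains.whole (P := P) k hk) A = QE (Domains.whole (P := P) k hk) x₀)
    (h3 : RE (Domains.whole (P := P) k hk) c (dsE c A) = 0) :
    lam = 0 ∧ -ω = EE (Domains.whole (P := P) k hk) hc hw (QE (Domains.whole (P := P) k hk) x₀) ∧
      A = Hk (opsV1 P k c s) ((opsV1 P k c s).Qk x₀) := by
  have hR' : RE (Domains.whole (P := P) k hk) c (-lam) = -lam := by rw [map_neg, hR]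
  have h1' : deltaAE (Domains.whole (P := P) k hk) c w A - dE c (RE (Domains.whole (P := P) k hk) c (-lam)) -
      QsE (Domains.whole (P := P) k hk) (-ω) = 0 := by
    rw [hR', map_neg, map_neg, sub_neg_eq_add, sub_neg_eq_add, add_right_comm]
    exact h1
  obtain ⟨hl, hω, hA⟩ := critical221_whole hk hc hs hw hR' h1' h3 h2
  exact ⟨neg_eq_zero.mp hl, hω, hA⟩

/-- … and `H_k(Q_kA₀)` satisfies the two constraint equations of (1.92)/(2.21) in p21's multi-scale form at the whole torus:
`QH_k(Q_kA₀) = QA₀`, `R∂*H_k(Q_kA₀) = 0` (p21's `isCritical_hOp_V1` read through `hOp_whole_eq_Hk`). [cite: Balaban1984PropagatorsI, (1.92) p.33] -/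
theorem Hk_admissible_whole (hc : c ≠ 0) (hs : s ≠ 0) (x₀ : BondSpace P) :
    QE (Domains.whole (P := P) k hk) (Hk (opsV1 P k c s) ((opsV1 P k c s).Qk x₀)) = QE (Domains.whole (P := P) k hk) x₀ ∧
      RE (Domains.whole (P := P) k hk) c (dsE c (Hk (opsV1 P k c s) ((opsV1 P k c s).Qk x₀))) = 0 := by
  have hw : ∀ i : BondIdx (Domains.whole (P := P) k hk), 0 < (fun _ => (1 : ℝ)) i := fun _ => one_pos
  have h := (isCritical_hOp_V1 (Domains.whole (P := P) k hk) hc hw (QE (Domains.whole (P := P) k hk) x₀)).1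
  rw [hOp_whole_eq_Hk hk hc hs hw] at h
  exact h

end

end Literature.MathematicalPhysics.QuantumFieldTheory.Balaban1983to89.B6SectAWholeTorusSectE
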